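import Literature.NumberTheory.Automorphic.HenniartAutomorphicInductionProofs
import HarnessLib

/-!
# Henniart's archimedean automorphic-induction statement: assembly along the printed proof line
(`Henniart2012_infinityType_of_automorphicInduction` from existence-with-archimedean-components
and rigidity; theorems only)

Topic `NumberTheory/Automorphic`; a proof file (theorems only: no definition, no named fact, no
instance) next to `HenniartAutomorphicInduction` / `HenniartAutomorphicInductionProofs` /
`HenniartAutomorphicInductionStages`.

The named fact `Henniart2012_infinityType_of_automorphicInduction` says: if a CUSPIDAL `P` on
`GL_{dn}(𝔸_K)` is automorphically induced (Henniart 2012, (1.1) at almost all finite places =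
Arthur–Clozel's Def. 6.1) from a cuspidal `π` on `GL_n(𝔸_L)`, `L/K` cyclic of degree `d`, then
the `z`-exponent multiset of `P` at `σ : K → ℂ` is the sum of those of `π` at the `σ' : L → ℂ`
over `σ`. Henniart's own proof line (§1.10 with §2.1) is two printed results and one remark:

1. **Existence with archimedean components** (Thm. 3: `τ^{E/F}` exists and is "induite
   automorphe de `τ`"; Thm. 5 and Remarque 2 of §1.14 / Remarque finale of §3.7: its component at
   an infinite place `v` is the local automorphic induction of `τ_v`, Henniart 2010, i.e. on
   Harish-Chandra parameters the sum over the embeddings above `σ`): there is SOME automorphic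
   `P'` on `GL_{dn}(𝔸_K)`, automorphically induced from `π`, whose archimedean parameter is
   `σ ↦ ∑_{σ' ∣ σ} χ_π(σ')` — hypothesis `hAI` below, the archimedean strengthening of the tree's
   named fact `automorphicInduction_cyclic` (Arthur–Clozel Thm. 6.2, existence only).
2. **Rigidity** (§2.1: "si `π'` est une représentation automorphe de `GL_n(𝔸_F)` … telle que
   `π'_v` soit isomorphe à `π_v` pour presque toute place `v` de `F`, alors `π'` est isomorphe à
   `π`", by Jacquet–Shalika 1981 II, Thm. 4.4, and the Remarque there: by Langlands [8] `π'` need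
   not be induced from unitary cuspidal): a cuspidal `P` and an automorphic `P'` with the same
   Satake parameters at almost all places are isomorphic, in particular `P'_∞ ≅ P_∞` has the
   Harish-Chandra parameter of `P` — hypothesis `hRig` below (archimedean shadow in the datum
   model, which has no isomorphisms of automorphic representation data).
3. The remark that two automorphic inductions of the same `π` have the same Satake parameters
   at almost every place (the relation (1.1) determines `t_{P,v}` from the `t_{π,w}`, `w ∣ v`), so
   that `P` and `P'` are nearly equivalent — PROVED here
   (`IsAutomorphicInductionAlong.eventually_hasSatakeParamAt_iff`, `.isNearlyEquivalent`).

`Henniart2012_infinityType_of_automorphicInduction_of_archAI_of_rigidity` assembles 1–3 with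
the uniqueness of archimedean parameters (`AutomorphicRepData.hasArchParameter_unique`,
Harish-Chandra) and the reading of infinity types (`HasInfinityType = IsWellFormed ∧
HasArchParameter (a-multisets)`), in every degree `d` at once (no induction in stages). The two
hypotheses are stated exactly in the shape of named facts of the tree's vocabulary
(`CuspidalAutomorphicRepData`, `IsAutomorphicInductionAlong`, `AutomorphicRepData.HasArchParameter`,
`AutomorphicRepData.IsNearlyEquivalent`), fully quantified inside, so that printed discharges of
either feed this theorem verbatim. Nothing here introduces a definition or a named fact.

## References

* G. Henniart, *Induction automorphe globale pour les corps de nombres*, Bull. Soc. Math. France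
  140 (2012) 1–17: §1.10, Thm. 3, Thm. 5, §1.14 Remarque 2, §2.1 and Remarque, Remarque finale
  de §3.7. [Henniart2012]
* G. Henniart, *Induction automorphe pour GL(n, ℂ)*, J. Funct. Anal. 258 (2010) 3082–3096.
* H. Jacquet, J. Shalika, *On Euler products and the classification of automorphic forms II*,
  Amer. J. Math. 103 (1981), Thm. 4.4. [JacquetShalikaAJM1981II]
* R. P. Langlands, *On the notion of an automorphic representation*, Proc. Sympos. Pure Math. 33,
  Part 1 (1979) 203–207, Prop. 2.
* J. Arthur, L. Clozel, Ann. of Math. Stud. 120 (1989), Ch. 3 Def. 6.1, Thm. 6.2.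
  [ArthurClozelAMS120]
* L. Clozel, *Motifs et formes automorphes* (1990), §3.3. [Clozel1990]
-/

noncomputable section

open scoped NumberField Polynomial Classical
open NumberField IsDedekindDomain Polynomial Filter Finset Literature.NumberTheory.Automorphic

namespace Literature.NumberTheory.Automorphic

/-! ### Two automorphic inductions of the same representation are nearly equivalent -/

section NearEquivalence

variable {K : Type} [Field K] [NumberField K] {L : Type} [Field L] [NumberField L] [Algebra K L]
  {N N' n : ℕ} {hK : isCompact_glFiniteIntegralLevel N K}
  {hK' : isCompact_glFiniteIntegralLevel N' K} {hL : isCompact_glFiniteIntegralLevel n L}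
  {π : AutomorphicRepData (AutomorphyDatum.gl n L hL)}
  {P : AutomorphicRepData (AutomorphyDatum.gl N K hK)}
  {P' : AutomorphicRepData (AutomorphyDatum.gl N' K hK')}

/-- **Two automorphic inductions of the same `π` have the same Satake parameters at almost every
place** (Henniart 2012, §1.10: the relations (1.1) determine `π = τ^{E/F}` "par rigidité"; the
elementary half of that remark — (1.1) determines the unramified components: at almost every `v`
the Satake parameters `β_w = t_{π,w}`, `w ∣ v`, exist and are unique (Flath), and
`t_{P,v}`, `t_{P',v}` are both the multiset of roots of `∏_{w ∣ v} P_{β_w}(X^{f(w|v)})`).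
Stated for `P`, `P'` of a priori different ranks `N`, `N'` (both are `n [L : K]`,
`IsAutomorphicInductionAlong.rank_eq`). [cite: Henniart2012, §1.10]
[cite: ArthurClozelAMS120, Ch. 3 Def. 6.1] -/
theorem IsAutomorphicInductionAlong.eventually_hasSatakeParamAt_iff
    (h : IsAutomorphicInductionAlong π P) (h' : IsAutomorphicInductionAlong π P') :
    ∀ᶠ v : HeightOneSpectrum (𝓞 K) in cofinite, ∀ α : Multiset ℂ,
      P.HasSatakeParamAt v α ↔ P'.HasSatakeParamAt v α := by
  filter_upwards [h.eventually_satakePolynomial_eq_iff, h'.eventually_satakePolynomial_eq_iff]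
    with v hv hv' α
  obtain ⟨β, hβ, hiff⟩ := hv
  obtain ⟨β', hβ', hiff'⟩ := hv'
  rw [hiff α, hiff' α, inducedSatakePolynomial_congr v fun w hw =>
    π.hasSatakeParamAt_unique_holds (hβ w hw) (hβ' w hw)]

/-- **Two automorphic inductions of the same `π` to the same `GL_N(𝔸_K)` are nearly equivalent**
(same Satake parameter at almost every finite place; Henniart 2012, §1.10; every automorphic
representation is unramified almost everywhere, Flath). [cite: Henniart2012, §1.10]
[cite: ArthurClozelAMS120, Ch. 3 Def. 6.1] -/
theorem IsAutomorphicInductionAlong.isNearlyEquivalent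
    {P P' : AutomorphicRepData (AutomorphyDatum.gl N K hK)}
    (h : IsAutomorphicInductionAlong π P) (h' : IsAutomorphicInductionAlong π P') :
    AutomorphicRepData.IsNearlyEquivalent P P' := by
  filter_upwards [h.eventually_hasSatakeParamAt_iff h', P.hasSatakeParamAt_cofinite_holds]
    with v hv hP
  obtain ⟨α, hα⟩ := hP
  exact ⟨α, hα, (hv α).mp hα⟩

end NearEquivalence

/-! ### The named fact from existence-with-archimedean-components and rigidity -/

section Assembly

/-- **Archimedean parameters of a cuspidal automorphic induction, along Henniart's proof line**
(Henniart 2012, §1.10 with §2.1, Thm. 3, Thm. 5 and Remarque finale §3.7). Granting, in the tree's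
Borel–Jacquet datum model:
`hAI` — **existence of automorphic induction through a cyclic extension with its archimedean
components** (Henniart 2012, Thm. 3, Thm. 5 and Remarque finale §3.7, with Henniart 2010 at the
infinite places; Arthur–Clozel 1989, Ch. 3 Thm. 6.2 for the existence, the tree's
`automorphicInduction_cyclic`): for `L/K` cyclic, `n ≥ 1`, `π` cuspidal on `GL_n(𝔸_L)`, there is
an automorphic `P'` on `GL_{n[L:K]}(𝔸_K)` automorphically induced from `π` (Def. 6.1 a.e.) such
that for every archimedean parameter `χ` of `π`, `σ ↦ ∑_{σ' ∣ σ} χ(σ')` is an archimedean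
parameter of `P'` (the rank `N = n [L : K]` is a free variable with that constraint, so that no
cast is needed to use it);
`hRig` — **rigidity, archimedean shadow** (Jacquet–Shalika 1981 II, Thm. 4.4, with Langlands
1979, Prop. 2, as quoted in Henniart 2012, §2.1 and Remarque): if a cuspidal `P` and an
automorphic `P'` on `GL_N(𝔸_K)`, `N ≥ 1`, are nearly equivalent, then every archimedean
parameter of `P` is an archimedean parameter of `P'` (in print `P' ≅ P`):
if a CUSPIDAL `P` on `GL_N(𝔸_K)` is automorphically induced from a cuspidal `π` on `GL_n(𝔸_L)`,
`L/K` cyclic, and `χ_P`, `χ_π` are archimedean parameters of `P`, `π`, then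
`χ_P σ = ∑_{σ' ∣ σ} χ_π σ'` for every `σ : K → ℂ`. Proof: `hAI` gives `P'` (of rank
`N = n [L : K]`, `IsAutomorphicInductionAlong.rank_eq`); `P`, `P'` are nearly equivalent
(`IsAutomorphicInductionAlong.isNearlyEquivalent`); `hRig` transports `χ_P` to `P'`; `hAI` gives
`P'` the parameter `σ ↦ ∑_{σ' ∣ σ} χ_π σ'`; archimedean parameters are unique
(`AutomorphicRepData.hasArchParameter_unique`, Harish-Chandra).
[cite: Henniart2012, §1.10, §2.1, Thm. 3, Thm. 5 and Remarque §3.7]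
[cite: JacquetShalikaAJM1981II, Thm. 4.4] [cite: ArthurClozelAMS120, Ch. 3 Thm. 6.2] -/
theorem IsAutomorphicInductionAlong.archParameter_eq_sum_of_archAI_of_rigidity
    (hAI : ∀ (n : ℕ) (K L : Type) [Field K] [NumberField K] [Field L] [NumberField L]
      [Algebra K L] [IsGalois K L], IsCyclic (L ≃ₐ[K] L) → 0 < n →
      ∀ (hL : isCompact_glFiniteIntegralLevel n L) (N : ℕ)
        (hK : isCompact_glFiniteIntegralLevel N K), N = n * Module.finrank K L →
        ∀ π : CuspidalAutomorphicRepData n L hL,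
          ∃ P : AutomorphicRepData (AutomorphyDatum.gl N K hK),
            IsAutomorphicInductionAlong π.1 P ∧
              ∀ χ : (L →+* ℂ) → Multiset ℂ, π.1.HasArchParameter χ →
                P.HasArchParameter fun σ =>
                  ∑ σ' ∈ Finset.univ.filter (fun σ' : L →+* ℂ => σ'.comp (algebraMap K L) = σ),
                    χ σ')
    (hRig : ∀ (N : ℕ) (K : Type) [Field K] [NumberField K]
      (hK : isCompact_glFiniteIntegralLevel N K), 0 < N →
      ∀ (P : CuspidalAutomorphicRepData N K hK) (P' : AutomorphicRepData (AutomorphyDatum.gl N K hK)),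
        AutomorphicRepData.IsNearlyEquivalent P.1 P' →
          ∀ χ : (K →+* ℂ) → Multiset ℂ, P.1.HasArchParameter χ → P'.HasArchParameter χ)
    {K L : Type} [Field K] [NumberField K] [Field L] [NumberField L] [Algebra K L] [IsGalois K L]
    (hcyc : IsCyclic (L ≃ₐ[K] L)) {n N : ℕ} (hn : 0 < n)
    {hK : isCompact_glFiniteIntegralLevel N K} {hL : isCompact_glFiniteIntegralLevel n L}
    {P : CuspidalAutomorphicRepData N K hK} {π : CuspidalAutomorphicRepData n L hL}
    (h : IsAutomorphicInductionAlong π.1 P.1) {χP : (K →+* ℂ) → Multiset ℂ}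
    {χπ : (L →+* ℂ) → Multiset ℂ} (hχP : P.1.HasArchParameter χP)
    (hχπ : π.1.HasArchParameter χπ) (σ : K →+* ℂ) :
    χP σ = ∑ σ' ∈ Finset.univ.filter (fun σ' : L →+* ℂ => σ'.comp (algebraMap K L) = σ),
      χπ σ' := by
  haveI : Module.Finite K L := Module.Finite.of_restrictScalars_finite ℚ K L
  have hN : N = n * Module.finrank K L := h.rank_eq
  have hNpos : 0 < N := hN ▸ Nat.mul_pos hn Module.finrank_pos
  -- Thm. 3 with Thm. 5 / Remarque §3.7: an automorphic induction `P'` of `π` with its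
  -- archimedean parameter
  obtain ⟨P', h', hArch'⟩ := hAI n K L hcyc hn hL N hK hN π
  -- (1.1) determines the unramified components: `P` and `P'` are nearly equivalent;
  -- rigidity (§2.1): `P'_∞` has the Harish-Chandra parameter of `P`
  have h₁ : P'.HasArchParameter χP := hRig N K hK hNpos P P' (h.isNearlyEquivalent h') χP hχP
  -- uniqueness of archimedean parameters (Harish-Chandra)
  exact congr_fun (P'.hasArchParameter_unique h₁ (hArch' χπ hχπ)) σ

/-- **`Henniart2012_infinityType_of_automorphicInduction` along Henniart's proof line**
(Henniart 2012, §1.10: a representation satisfying (1.1) "est alors unique à isomorphisme près"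
by rigidity, §2.1, and is `τ^{E/F}` of Thm. 3, whose archimedean components are given by Thm. 5
with Remarque 2 of §1.14 and the Remarque finale of §3.7): granting `hAI` (existence of cyclic
automorphic induction with its archimedean components) and `hRig` (rigidity of cuspidal among
automorphic representations, archimedean shadow), both as in
`IsAutomorphicInductionAlong.archParameter_eq_sum_of_archAI_of_rigidity`, the named fact holds
in every degree: its hypothesis is `IsAutomorphicInductionAlong π P`
(`eventually_satakeRelation_iff_isAutomorphicInductionAlong`), and an infinity type `T` of `P`
(resp. `π`) carries the archimedean parameter `σ ↦ (T σ).map a` (Clozel 1990, §3.3).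
[cite: Henniart2012, §1.10, §2.1, Thm. 3, Thm. 5 and Remarque §3.7]
[cite: JacquetShalikaAJM1981II, Thm. 4.4] [cite: ArthurClozelAMS120, Ch. 3 Thm. 6.2]
[cite: Clozel1990, §3.3] -/
theorem Henniart2012_infinityType_of_automorphicInduction_of_archAI_of_rigidity
    (hAI : ∀ (n : ℕ) (K L : Type) [Field K] [NumberField K] [Field L] [NumberField L]
      [Algebra K L] [IsGalois K L], IsCyclic (L ≃ₐ[K] L) → 0 < n →
      ∀ (hL : isCompact_glFiniteIntegralLevel n L) (N : ℕ)
        (hK : isCompact_glFiniteIntegralLevel N K), N = n * Module.finrank K L →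
        ∀ π : CuspidalAutomorphicRepData n L hL,
          ∃ P : AutomorphicRepData (AutomorphyDatum.gl N K hK),
            IsAutomorphicInductionAlong π.1 P ∧
              ∀ χ : (L →+* ℂ) → Multiset ℂ, π.1.HasArchParameter χ →
                P.HasArchParameter fun σ =>
                  ∑ σ' ∈ Finset.univ.filter (fun σ' : L →+* ℂ => σ'.comp (algebraMap K L) = σ),
                    χ σ')
    (hRig : ∀ (N : ℕ) (K : Type) [Field K] [NumberField K]
      (hK : isCompact_glFiniteIntegralLevel N K), 0 < N →
      ∀ (P : CuspidalAutomorphicRepData N K hK) (P' : AutomorphicRepData (AutomorphyDatum.gl N K hK)),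
        AutomorphicRepData.IsNearlyEquivalent P.1 P' →
          ∀ χ : (K →+* ℂ) → Multiset ℂ, P.1.HasArchParameter χ → P'.HasArchParameter χ) :
    Henniart2012_infinityType_of_automorphicInduction := by
  rw [Henniart2012_infinityType_of_automorphicInduction_iff_along]
  intro K L _ _ _ _ _ _ hcyc n d hn hd hK hL P π hAlong TP Tπ hTP hTπ σ
  exact hAlong.archParameter_eq_sum_of_archAI_of_rigidity hAI hRig hcyc hn hTP.2 hTπ.2 σ

end Assembly

end Literature.NumberTheory.Automorphic
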